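import Summits.AtomisticToContinuum.Crystallization.Theorems.FreeSplittingCertificatesStrictSplittingRuleFarPencilHcp
import Summits.AtomisticToContinuum.Crystallization.Theorems.FreeSplittingCertificatesStrictSplittingRuleHcpFamilyMinLocalised

/-!
# `StrictSplittingRule` (stmt-AtomisticToContinuum-12560): the far pencil against hcp shell receipts AT THE TRUE MINIMISER (ratio-robust sandwich)

Route `FreeSplittingCertificates`, crux r3 `StrictSplittingRule` (H12⋆ = `stub_coreJointCoercive`), unit b2b-freesplit-B gen 10.
VALUE = a box-free receipts sandwich and the continuum far lemma at the exact (irrational) hcp-family minimiser — NOT a proof of H12⋆, NOT summit progress.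

`…FarPencilHcp` has the sharp factor `6/5` only at the ideal ratio `h² = 2a²/3` and the crude `4/μ` otherwise.  The registered H12⋆ lives at the exact
minimiser `(a,h)` of the hcp family (`HcpFamilyMin a h`; tree enclosure `|a − 0.97129| ≤ 10⁻⁴`, `|h − 0.79294| ≤ 10⁻⁴`, ratio `h²/a² = 0.6665 ± 3·10⁻⁴`,
NOT ideal).  Here: for EVERY `(a,h)` with `h² ≥ (333/500)a²` the shell form dominates `(333/400)` of the isotropic twelve-design form
(`hcpShell_strain_form_ge_of_ratio`; blockwise: deviator and in-plane shear have slack `25/24`, the out-of-plane shears bind at `5(h²/a²)/4 ≥ 333/400`, the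
trace-type `2×2` block is positive definite by an explicit completed square), hence `fpRec_le_shell_of_ratio : (333/400)·a⁴·fpRec G ≤ fpShell a h G`,
`ratio_of_hcpFamilyMin : HcpFamilyMin a h → (333/500)a² ≤ h²`, and
**`farPencil_integral_le_hcpShell_min`: at the true minimiser, `∫ Num ≤ (17/200)·(400/333)·a⁻⁴·∫ |x|⁻⁶·Σ_{s∈shell}⟪y_s, ∇v y_s⟫²`** for every `C²` compactly
supported field with `0 ∉ tsupport v` (`(17/200)(400/333) = 0.1021` vs `(17/200)(6/5) = 0.102` at the ideal ratio).  NOT a proof of H12⋆, NOT summit progress.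
-/

noncomputable section

open MeasureTheory Topology Filter
open scoped BigOperators

namespace Summit.AtomisticToContinuum.Crystallization.Theorems.StrictSplittingRuleBirth

open Literature.MathematicalPhysics.StatisticalMechanics
open Summit.AtomisticToContinuum.Crystallization.Theorems.PalmUnimodularRigidity.LayeredLawsSelectHcp

variable {v : (Fin 3 → ℝ) → (Fin 3 → ℝ)}

/-- **Ratio-robust lower sandwich**: if `h² ≥ (333/500)a²` then `Σ_s ⟪y_s, E y_s⟫² ≥ (333/400)·(4/5)a⁴((tr E)² + 2‖E‖²_F)` for every symmetric `E`. -/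
theorem hcpShell_strain_form_ge_of_ratio (a h e₀₀ e₁₁ e₂₂ e₀₁ e₀₂ e₁₂ : ℝ) (hT : 333 / 500 * a ^ 2 ≤ h ^ 2) :
    333 / 400 * (4 / 5 * a ^ 4 * ((e₀₀ + e₁₁ + e₂₂) ^ 2 +
        2 * (e₀₀ ^ 2 + e₁₁ ^ 2 + e₂₂ ^ 2 + 2 * e₀₁ ^ 2 + 2 * e₀₂ ^ 2 + 2 * e₁₂ ^ 2))) ≤
      ∑ s ∈ hcpStarIdx,
        (e₀₀ * hcpSite a h s 0 ^ 2 + e₁₁ * hcpSite a h s 1 ^ 2 + e₂₂ * hcpSite a h s 2 ^ 2 +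
            2 * e₀₁ * (hcpSite a h s 0 * hcpSite a h s 1) + 2 * e₀₂ * (hcpSite a h s 0 * hcpSite a h s 2) +
          2 * e₁₂ * (hcpSite a h s 1 * hcpSite a h s 2)) ^ 2 := by
  rw [hcpShell_strain_form]
  -- trace-type block: `A u² + B u w + C w²`, `u = a²(e₀₀+e₁₁)`, `w = e₂₂`, `A = 251/750` constant; complete the square.
  have hδ : 0 ≤ h ^ 2 - 333 / 500 * a ^ 2 := sub_nonneg.2 hT
  have hres : 0 ≤ 6 * h ^ 4 - 999 / 500 * a ^ 4 - 375 / 502 * (2 * h ^ 2 - 333 / 250 * a ^ 2) ^ 2 := by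
    nlinarith [mul_nonneg hδ (sq_nonneg a), sq_nonneg (h ^ 2 - 333 / 500 * a ^ 2), sq_nonneg (a ^ 2), mul_nonneg hδ hδ]
  have hblk : ∀ u w : ℝ, 251 / 750 * u ^ 2 + (2 * h ^ 2 - 333 / 250 * a ^ 2) * u * w + (6 * h ^ 4 - 999 / 500 * a ^ 4) * w ^ 2 =
      251 / 750 * (u + 375 / 251 * (2 * h ^ 2 - 333 / 250 * a ^ 2) * w) ^ 2 +
        (6 * h ^ 4 - 999 / 500 * a ^ 4 - 375 / 502 * (2 * h ^ 2 - 333 / 250 * a ^ 2) ^ 2) * w ^ 2 := by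
    intro u w; ring
  have htr : 0 ≤ 251 / 750 * (a ^ 2 * (e₀₀ + e₁₁)) ^ 2 + (2 * h ^ 2 - 333 / 250 * a ^ 2) * (a ^ 2 * (e₀₀ + e₁₁)) * e₂₂ +
      (6 * h ^ 4 - 999 / 500 * a ^ 4) * e₂₂ ^ 2 := by
    rw [hblk]
    exact add_nonneg (mul_nonneg (by norm_num) (sq_nonneg _)) (mul_nonneg hres (sq_nonneg _))
  have hsh : 0 ≤ (4 * a ^ 2 * h ^ 2 - 333 / 125 * a ^ 4) * (e₀₂ ^ 2 + e₁₂ ^ 2) := by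
    refine mul_nonneg ?_ (by positivity)
    nlinarith [mul_nonneg hδ (sq_nonneg a)]
  nlinarith [htr, hsh, mul_nonneg (sq_nonneg (a ^ 2)) (sq_nonneg (e₀₀ - e₁₁)), mul_nonneg (sq_nonneg (a ^ 2)) (sq_nonneg e₀₁)]

/-- **Ratio-robust receipts sandwich**: `(333/400)·a⁴·fpRec G ≤ fpShell a h G` whenever `h² ≥ (333/500)a²`. -/
theorem fpRec_le_shell_of_ratio (a h : ℝ) (hT : 333 / 500 * a ^ 2 ≤ h ^ 2) (G : Fin 3 → Fin 3 → ℝ) :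
    333 / 400 * (a ^ 4 * fpRec G) ≤ fpShell a h G := by
  have h1 := hcpShell_strain_form_ge_of_ratio a h (G 0 0) (G 1 1) (G 2 2) ((G 0 1 + G 1 0) / 2) ((G 0 2 + G 2 0) / 2)
    ((G 1 2 + G 2 1) / 2) hT
  have hS : fpShell a h G = ∑ s ∈ hcpStarIdx,
      (G 0 0 * hcpSite a h s 0 ^ 2 + G 1 1 * hcpSite a h s 1 ^ 2 + G 2 2 * hcpSite a h s 2 ^ 2 +
          2 * ((G 0 1 + G 1 0) / 2) * (hcpSite a h s 0 * hcpSite a h s 1) +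
          2 * ((G 0 2 + G 2 0) / 2) * (hcpSite a h s 0 * hcpSite a h s 2) +
        2 * ((G 1 2 + G 2 1) / 2) * (hcpSite a h s 1 * hcpSite a h s 2)) ^ 2 := rfl
  have hR : fpRec G = 4 / 5 * ((G 0 0 + G 1 1 + G 2 2) ^ 2 +
      2 * (G 0 0 ^ 2 + G 1 1 ^ 2 + G 2 2 ^ 2 + 2 * ((G 0 1 + G 1 0) / 2) ^ 2 + 2 * ((G 0 2 + G 2 0) / 2) ^ 2 +
        2 * ((G 1 2 + G 2 1) / 2) ^ 2)) := by
    unfold fpRec fpTr fpSymSq; ring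
  rw [hS, hR]
  linarith

/-- **The true minimiser has `h² ≥ (333/500)a²`** (tree enclosure `hcpFamilyMin_enclosure`: `h²/a² ≥ (0.79284/0.97139)² = 0.66618 > 0.666`). -/
theorem ratio_of_hcpFamilyMin {a h : ℝ} (ha : 0 < a) (hh : 0 < h) (hfam : HcpFamilyMin a h) : 333 / 500 * a ^ 2 ≤ h ^ 2 := by
  obtain ⟨hA, hH⟩ := hcpFamilyMin_enclosure ha hh hfam
  obtain ⟨ha1, ha2⟩ := abs_le.1 hA
  obtain ⟨hh1, hh2⟩ := abs_le.1 hH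
  nlinarith [ha, hh]

/-- **The far pencil against shell receipts, ratio-robust**: `h² ≥ (333/500)a²`, `a ≠ 0` ⇒
`∫ Num ≤ (17/200)·(400/333)·a⁻⁴·∫ |x|⁻⁶·fpShell a h (∇v)` for every `C²` compactly supported field with `0 ∉ tsupport v`. -/
theorem farPencil_integral_le_hcpShell_of_ratio (hv : ContDiff ℝ 2 v) (hc : HasCompactSupport v) (h0 : (0 : Fin 3 → ℝ) ∉ tsupport v)
    {a h : ℝ} (ha : a ≠ 0) (hT : 333 / 500 * a ^ 2 ≤ h ^ 2) :
    ∫ x, fpNum x (v x) (fpGrad v x) ≤ 17 / 200 * (400 / 333 * (a ^ 4)⁻¹) * ∫ x, (fpSq x)⁻¹ ^ 3 * fpShell a h (fpGrad v x) := by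
  have hmain := farPencil_integral_le hv hc h0
  have iD := integrable_fpDen hv hc h0
  have iS := integrable_fpShell hv hc h0 a h
  have ha4 : 0 < a ^ 4 := by positivity
  have hpt : ∀ x, fpDen x (fpGrad v x) ≤ 400 / 333 * (a ^ 4)⁻¹ * ((fpSq x)⁻¹ ^ 3 * fpShell a h (fpGrad v x)) := by
    intro x
    have hu : 0 ≤ (fpSq x)⁻¹ ^ 3 := pow_nonneg (inv_nonneg.2 (fpSq_nonneg x)) 3
    have h1 := fpRec_le_shell_of_ratio a h hT (fpGrad v x)
    have h2 : fpRec (fpGrad v x) ≤ 400 / 333 * (a ^ 4)⁻¹ * fpShell a h (fpGrad v x) := by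
      rw [show 400 / 333 * (a ^ 4)⁻¹ * fpShell a h (fpGrad v x) = (a ^ 4)⁻¹ * (400 / 333 * fpShell a h (fpGrad v x)) by ring]
      rw [le_inv_mul_iff₀ ha4]
      linarith
    unfold fpDen
    nlinarith [mul_le_mul_of_nonneg_left h2 hu]
  have h3 : ∫ x, fpDen x (fpGrad v x) ≤ ∫ x, 400 / 333 * (a ^ 4)⁻¹ * ((fpSq x)⁻¹ ^ 3 * fpShell a h (fpGrad v x)) :=
    integral_mono iD (iS.const_mul _) hpt
  rw [integral_const_mul] at h3
  nlinarith [hmain, h3]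

/-- **THE CONTINUUM FAR PENCIL AGAINST HCP SHELL RECEIPTS AT THE TRUE MINIMISER**: for the exact hcp-family minimiser `(a,h)`
(`HcpFamilyMin a h`) and every `C²` compactly supported field with `0 ∉ tsupport v`,
`∫ Num ≤ (17/200)·(400/333)·a⁻⁴·∫ |x|⁻⁶·Σ_{s∈shell}⟪y_s, ∇v y_s⟫²`.  NOT a proof of H12⋆, NOT summit progress. -/
theorem farPencil_integral_le_hcpShell_min (hv : ContDiff ℝ 2 v) (hc : HasCompactSupport v) (h0 : (0 : Fin 3 → ℝ) ∉ tsupport v)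
    {a h : ℝ} (ha : 0 < a) (hh : 0 < h) (hfam : HcpFamilyMin a h) :
    ∫ x, fpNum x (v x) (fpGrad v x) ≤ 17 / 200 * (400 / 333 * (a ^ 4)⁻¹) * ∫ x, (fpSq x)⁻¹ ^ 3 * fpShell a h (fpGrad v x) :=
  farPencil_integral_le_hcpShell_of_ratio hv hc h0 ha.ne' (ratio_of_hcpFamilyMin ha hh hfam)

end Summit.AtomisticToContinuum.Crystallization.Theorems.StrictSplittingRuleBirth
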